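import Literature.NumberTheory.DiophantineApproximation.DilogHermitePade
import HarnessLib

/-!
# Linear independence of `1, Li₁(±1/N), Li₂(±1/N)` over `ℚ` for large `N` (David–Hirata-Kohno–Kawashima 2020, Thm 2.1) — named fact

Topic `Literature/NumberTheory/DiophantineApproximation`. ONE named fact (`def … : Prop`, D-0014), requested by route
`KontsevichZagierPeriods/HermiteRigidity` (crux `ReductionRigidity`, lead seat c6, growth "duplication join island": the box
sectors at the THREE levels `N, −N, N²` joined by the duplication move chain `Li₂(1/N²) = 2Li₂(1/N) + 2Li₂(−1/N)` and the
weight-one duplication `log(N²/(N²−1)) = log(N/(N−1)) + log(N/(N+1))`); the census of that crux lists it as growth item G9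
("multi-point DHK Thm 2.1 ⇒ weight-two islands at finitely many distinct levels").

## Source and statement

S. David, N. Hirata-Kohno, M. Kawashima, *Can polylogarithms at algebraic points be linearly independent?*, Moscow J. Comb.
Number Theory 9 (2020) 389–406 = arXiv:1912.03811 (held, read), Theorem 2.1: for a number field `K`, `x ∈ ℚ ∩ [0,1)`,
`r, m ≥ 1`, pairwise distinct `α₁, …, α_m ∈ K ∖ {0}` and `β ∈ K ∖ {0}` with `max|αᵢ| < |β|`, IF `V(α, β, x) > 0` THEN the
`rm + 1` numbers `1, Φ₁(x, α₁/β), …, Φ_r(x, α₁/β), …, Φ₁(x, α_m/β), …, Φ_r(x, α_m/β)` are linearly independent over `K`,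
where `Φ_s(x, z) = Σ_{k ≥ 0} z^{k+1}/(k+x+1)^s` (`Φ_s(0, z) = Li_s(z) = Σ_{k≥0} z^{k+1}/(k+1)^s`, §1) and (§2)
`V = 𝔸 + 𝒜^{(1)} − (Σ_{g ≤ [K:ℚ]} 𝒜^{(g)})/[K_∞:ℚ]`,
`𝔸(α, β, x) = log|β| − (rm+1) log maxᵢ|αᵢ| − {rm(log D(α,β) + r[den(x) + log(5/2)]) + r(log 3 + log μ(x))}`,
`D(α, β) = den(α₁, …, α_m, β)`, `μ(x) = den(x)·∏_{q | den(x)} q^{1/(q−1)}`.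
INSTANCE used here: `K = ℚ` (so `[K:ℚ] = [K_∞:ℚ] = 1` and `V = 𝔸`), `x = 0` (`den(0) = μ(0) = 1`), `r = m = 2`,
`α = (1, −1)`, `β = N` (`D = 1`, `maxᵢ|αᵢ| = 1`): `V = log N − 8(1 + log(5/2)) − 2 log 3 = log N − 17.53… > 0` for every
integer `N ≥ 10⁸` (indeed for `N ≥ 4.2·10⁷`). Conclusion: **for `N ≥ 10⁸` the five numbers
`1, Li₁(1/N), Li₂(1/N), Li₁(−1/N), Li₂(−1/N)` are linearly independent over `ℚ`**. Here `Li_s(z)` is the tree's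
`DilogPade.polylogSeries s z = Σ_{k≥0} z^{k+1}/(k+1)^s` (`Literature/NumberTheory/DiophantineApproximation/DilogHermitePade.lean`),
the same indexing as the paper's.

## What is NOT here

The proof (Padé approximants of Nikišin–Rhin–Toffin type, non-vanishing of a Hermite-type determinant); other `x`, `K`,
`r`, `m`; the one-point case, PROVED in the tree for large `N` (`one_polylog_linearIndependent`, `PolylogLinearIndependence.lean`).

## References

* S. David, N. Hirata-Kohno, M. Kawashima, Moscow J. Comb. Number Theory 9:4 (2020) 389–406, doi:10.2140/moscow.2020.9.389,
  arXiv:1912.03811: §1 (`Φ_s`, `Li_s`), §2 (`den`, `μ`, `D`, `𝔸`, `𝒜^{(g)}`, `V`), Theorem 2.1. [DavidHirataKohnoKawashima2020]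
-/

noncomputable section

namespace Literature.NumberTheory.DiophantineApproximation

/-- NAMED FACT (David–Hirata-Kohno–Kawashima 2020, Theorem 2.1 with `K = ℚ`, `x = 0`, `r = m = 2`, `α = (1, −1)`,
`β = N`; `V = log N − 8(1 + log(5/2)) − 2 log 3 > 0` for `N ≥ 10⁸`): **for every integer `N ≥ 10⁸` the numbers
`1, Li₁(1/N), Li₂(1/N), Li₁(−1/N), Li₂(−1/N)` (`Li_s = DilogPade.polylogSeries s`) are linearly independent over `ℚ`** —
every rational relation `a + b₁Li₁(1/N) + c₁Li₂(1/N) + b₂Li₁(−1/N) + c₂Li₂(−1/N) = 0` is trivial. Users take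
`(h : DHK2020_dilogTwoPointsLinearIndependent)`. [cite: DavidHirataKohnoKawashima2020, Thm 2.1] -/
def DHK2020_dilogTwoPointsLinearIndependent : Prop :=
  ∀ N : ℕ, 10 ^ 8 ≤ N → ∀ a b₁ c₁ b₂ c₂ : ℚ,
    (a : ℝ) + b₁ * DilogPade.polylogSeries 1 (1 / (N : ℝ)) + c₁ * DilogPade.polylogSeries 2 (1 / (N : ℝ)) +
        b₂ * DilogPade.polylogSeries 1 (-(1 / (N : ℝ))) + c₂ * DilogPade.polylogSeries 2 (-(1 / (N : ℝ))) = 0 →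
      a = 0 ∧ b₁ = 0 ∧ c₁ = 0 ∧ b₂ = 0 ∧ c₂ = 0

/-- The weight-two sub-statement with no logarithmic terms (convenience form). [cite: DavidHirataKohnoKawashima2020, Thm 2.1] -/
theorem DHK2020_dilogTwoPointsLinearIndependent.dilog_part (h : DHK2020_dilogTwoPointsLinearIndependent) (N : ℕ)
    (hN : 10 ^ 8 ≤ N) (a c₁ c₂ : ℚ)
    (hrel : (a : ℝ) + c₁ * DilogPade.polylogSeries 2 (1 / (N : ℝ)) + c₂ * DilogPade.polylogSeries 2 (-(1 / (N : ℝ))) = 0) :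
    a = 0 ∧ c₁ = 0 ∧ c₂ = 0 := by
  have := h N hN a 0 c₁ 0 c₂ (by push_cast; linear_combination hrel)
  exact ⟨this.1, this.2.2.1, this.2.2.2.2⟩

end Literature.NumberTheory.DiophantineApproximation

end
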